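import Literature.Barriers.BirchSwinnertonDyer.RankNotSumOfLocalInvariantsF3NormDescentProofs
import HarnessLib

/-!
# Barrier (BirchSwinnertonDyer), rank mod `5`: the `n = 5` leaf from the norm-`1` part of the six quintic `2`-descents

Towards the named facts `Literature.Barriers.BirchSwinnertonDyer.DokchitserDokchitser2011_rank_480a1_F5`
and `…_mordellWeilRank_480a1_F5` (`RankNotSumOfLocalInvariantsProofs.lean`,
`RankNotSumOfLocalInvariantsF5.lean`): "`F₅` = the degree 25 subfield of `ℚ(ζ₁₁, ζ₂₄₁)` […]
2-descent shows that `rk E/F₅ = 1` (e.g. using Magma, over all minimal non-trivial subfields of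
`F_n`)" for `E = 480a1 : y² = x(x+2)(x-3)`, proof of Theorem 2 of T. Dokchitser–V. Dokchitser,
*A note on the Mordell–Weil rank modulo `n`*, J. Number Theory 131 (2011) 1833–1839
(arXiv:0910.4588). The tree has: `F₅ = F5 (CyclotomicField 2651 ℚ)` with
`Gal(F₅/ℚ) ≅ C₅ × C₅` and its splitting (`RankNotSumOfLocalInvariantsF5.lean`,
`…F5Quintic.lean`), the reduction of `rk E(F₅) = 1` to the six quintic subfields
`F₅^{⟨σ⟩} = fixedField (zpowers σ)`, `σ ≠ 1`, with the weak bound `rk E(F₅^{⟨σ⟩}) ≤ 4`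
(`…WeakSubfieldBoundsProofs.lean`: Artin formalism for `C₅` and `rk E(ℚ) = 1` by a complete
`2`-descent over `ℚ` in Lean), and the odd-degree `2`-descent theorem
`WeierstrassCurve.mordellWeilRank_baseChange_eq_of_odd_of_twoDescent_norm`
(`Literature/NumberTheory/EllipticCurves/TwoDescentNormKernel.lean`), already specialised to
`480a1` over any Galois number field of odd degree
(`curve480a1.mordellWeilRank_baseChange_eq_one_of_odd_of_normDescent`,
`…F3NormDescentProofs.lean`). This file is the `n = 5` twin of `…F3NormDescentProofs.lean`: the
leaf follows from a purely diophantine statement about each quintic field `F₅^{⟨σ⟩}` alone,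

> every `(x, y) ∈ E(F₅^{⟨σ⟩})` with `x ≠ 0, -2, 3` such that `N(x)` and `N(x + 2)` are rational
> squares has `x` and `x + 2` squares in `F₅^{⟨σ⟩}` (`N = N_{F₅^{⟨σ⟩}/ℚ}`),

i.e. the classes of norm `1` in the `2`-Selmer image of `E(F₅^{⟨σ⟩})` are trivial — only the NEW
part of the Selmer image over the quintic field is concerned (the part over `ℚ` is the tree's
theorem `curve480a1.mordellWeilRank_eq_one`), and the two norm conditions are hypotheses (at a
prime of `F₅^{⟨σ⟩}` inert over `ℚ` they force even valuations of `x`, `x + 2`).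

| statement | declaration | status |
|---|---|---|
| `σ ≠ 1` + norm-`1` descent statement over `F₅^{⟨σ⟩}` ⟹ `rk E(F₅^{⟨σ⟩}) = 1` | `DokchitserDokchitser2011.F5.mordellWeilRank_curve480a1_fixedField_eq_one_of_normDescent` | proved |
| the six statements ⟹ `rk E(F₅) = 1` (any cyclotomic `K ⊇ ℚ` of level `2651`) | `DokchitserDokchitser2011.F5.mordellWeilRank_curve480a1_eq_one_of_quintic_normDescent` | proved |
| the six statements ⟹ the rank leaf `…_mordellWeilRank_480a1_F5` and the `n = 5` fact `…_rank_480a1_F5` | `DokchitserDokchitser2011_mordellWeilRank_480a1_F5_of_quintic_normDescent`, `DokchitserDokchitser2011_rank_480a1_F5_of_quintic_normDescent` | proved |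
| the six norm-`1` descent statements themselves (cyclic quintic fields of conductor `11`, `241`, `2651` (four): units, `2`-part of the class group, local images above `2, 3, 5`) | hypothesis `h` | NOT formalised; no new named fact (the debt stays with `…_mordellWeilRank_480a1_F5`) |

## Design notes

Theorems only (no definitions, no named facts; D-0026). The quintic subfields and their Galois
property are handled exactly as in `RankNotSumOfLocalInvariantsWeakSubfieldBoundsProofs.lean`
(`IsGalois.of_fixedField_normal_subgroup` under `IsAbelianGalois ℚ (F5 K)` from
`IsCyclotomicExtension.isAbelianGalois`), elaborated with
`set_option backward.isDefEq.respectTransparency false` across the `ℚ`-algebra instance diamond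
on intermediate fields, as in the F5 / F5Quintic / WeakSubfieldBounds files.

## References

* T. Dokchitser, V. Dokchitser, *A note on the Mordell–Weil rank modulo `n`*, J. Number Theory 131
  (2011) 1833–1839, arXiv:0910.4588: proof of Thm. 2 (p. 3 of the held arXiv copy).
  [DokchitserDokchitser2011RankModN]
* J. H. Silverman, *The Arithmetic of Elliptic Curves*, 2nd ed., GTM 106 (2009), Prop. X.1.4,
  Thm. VIII.6.7. [SilvermanAEC2009]
-/

noncomputable section

open scoped Classical NumberField

open NumberField WeierstrassCurve IntermediateField

namespace Literature.Barriers.BirchSwinnertonDyer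

namespace DokchitserDokchitser2011

variable (K : Type) [Field K] [NumberField K] [IsCyclotomicExtension {2651} ℚ K]

set_option backward.isDefEq.respectTransparency false in
/-- **`rk E(F₅^{⟨σ⟩}) = 1` over a quintic subfield of `F₅` from the norm-`1` part of its
`2`-descent.** For `E = 480a1` and a quintic subfield `F₅^{⟨σ⟩} = fixedField (zpowers σ)`
(`σ ≠ 1`) of `F₅ = F5 K` (`Gal(F₅^{⟨σ⟩}/ℚ) ≅ C₅`, as `F₅/ℚ` is abelian;
`F5.finrank_fixedField_zpowers`): if for every `(x, y) ∈ E(F₅^{⟨σ⟩})` with `x ≠ 0, -2, 3` whose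
`N(x)` and `N(x + 2)` are rational squares the elements `x`, `x + 2` are squares in `F₅^{⟨σ⟩}`,
then `rk_ℤ E(F₅^{⟨σ⟩}) = 1` (`curve480a1.mordellWeilRank_baseChange_eq_one_of_odd_of_normDescent`
at the odd degree `5`). This is the part of "2-descent […] over all minimal non-trivial
subfields" (proof of Thm. 2) that goes beyond the descent over `ℚ` (`rk E(ℚ) = 1`, proved in the
tree). [cite: DokchitserDokchitser2011RankModN, proof of Thm. 2] -/
theorem F5.mordellWeilRank_curve480a1_fixedField_eq_one_of_normDescent {σ : Gal((F5 K)/ℚ)}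
    (hσ : σ ≠ 1)
    (h : ∀ x y : fixedField (Subgroup.zpowers σ),
      (curve480a1.baseChange (fixedField (Subgroup.zpowers σ))).toAffine.Nonsingular x y →
      x ≠ 0 → x ≠ -2 → x ≠ 3 → IsSquare (Algebra.norm ℚ x) → IsSquare (Algebra.norm ℚ (x + 2)) →
      IsSquare x ∧ IsSquare (x + 2)) :
    (curve480a1.baseChange (fixedField (Subgroup.zpowers σ))).mordellWeilRank = 1 := by
  haveI := IsCyclotomicExtension.isAbelianGalois {2651} ℚ K
  haveI : IsAbelianGalois ℚ (F5 K) := inferInstance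
  haveI : IsGalois ℚ (fixedField (Subgroup.zpowers σ)) :=
    IsGalois.of_fixedField_normal_subgroup (Subgroup.zpowers σ)
  have hodd : Odd (Module.finrank ℚ (fixedField (Subgroup.zpowers σ))) := by
    rw [F5.finrank_fixedField_zpowers K hσ]
    exact ⟨2, rfl⟩
  exact curve480a1.mordellWeilRank_baseChange_eq_one_of_odd_of_normDescent
    (fixedField (Subgroup.zpowers σ)) hodd h

set_option backward.isDefEq.respectTransparency false in
/-- **`rk E(F₅) = 1` from the norm-`1` parts of the six quintic `2`-descents.** For `E = 480a1`
and `F₅ = F5 K` (`Gal(F₅/ℚ) ≅ C₅ × C₅`), if over each of the six quintic subfields `F₅^{⟨σ⟩}`,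
`σ ≠ 1`, every point `(x, y) ∈ E(F₅^{⟨σ⟩})`, `x ≠ 0, -2, 3`, with `N(x)` and `N(x + 2)` rational
squares has `x`, `x + 2` squares in `F₅^{⟨σ⟩}`, then `rk_ℤ E(F₅) = 1`: each `rk E(F₅^{⟨σ⟩}) = 1`
(`F5.mordellWeilRank_curve480a1_fixedField_eq_one_of_normDescent`) and the `C₅ × C₅` descent
`F5.mordellWeilRank_curve480a1_eq_one_of_quintic_le_four` concludes.
[cite: DokchitserDokchitser2011RankModN, proof of Thm. 2] -/
theorem F5.mordellWeilRank_curve480a1_eq_one_of_quintic_normDescent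
    (h : ∀ σ : Gal((F5 K)/ℚ), σ ≠ 1 → ∀ x y : fixedField (Subgroup.zpowers σ),
      (curve480a1.baseChange (fixedField (Subgroup.zpowers σ))).toAffine.Nonsingular x y →
      x ≠ 0 → x ≠ -2 → x ≠ 3 → IsSquare (Algebra.norm ℚ x) → IsSquare (Algebra.norm ℚ (x + 2)) →
      IsSquare x ∧ IsSquare (x + 2)) :
    (curve480a1.baseChange (F5 K)).mordellWeilRank = 1 :=
  F5.mordellWeilRank_curve480a1_eq_one_of_quintic_le_four K fun σ hσ =>
    (F5.mordellWeilRank_curve480a1_fixedField_eq_one_of_normDescent K hσ (h σ hσ)).le.trans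
      (by norm_num)

end DokchitserDokchitser2011

open DokchitserDokchitser2011

set_option backward.isDefEq.respectTransparency false in
/-- **The rank leaf from the norm-`1` parts of the six quintic `2`-descents.** The tree's named
fact `DokchitserDokchitser2011_mordellWeilRank_480a1_F5` — `rk_ℤ E(F₅) = 1` for `E = 480a1` and
`F₅ = DokchitserDokchitser2011.F5 (CyclotomicField 2651 ℚ)` — follows from the following statement
about each of the six quintic subfields `F₅^{⟨σ⟩}`, `σ ≠ 1`, alone: every point
`(x, y) ∈ E(F₅^{⟨σ⟩})`, `x ≠ 0, -2, 3`, with `N(x)` and `N(x + 2)` rational squares has `x` and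
`x + 2` squares in `F₅^{⟨σ⟩}` — i.e. the classes of norm `1` in the `2`-Selmer image of
`E(F₅^{⟨σ⟩})` are trivial. Everything else (`C₅ × C₅`, the Artin formalism for `C₅`,
`rk E(ℚ) = 1` by `2`-descent over `ℚ`, Mordell–Weil, the odd-degree norm-kernel descent) is a
theorem of the tree. What remains open towards `…_mordellWeilRank_480a1_F5_holds` is exactly this
diophantine statement over the cyclic quintic fields of conductors `11`, `241`, `2651` (four).
[cite: DokchitserDokchitser2011RankModN, proof of Thm. 2] -/
theorem DokchitserDokchitser2011_mordellWeilRank_480a1_F5_of_quintic_normDescent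
    (h : ∀ σ : Gal((F5 (CyclotomicField 2651 ℚ))/ℚ), σ ≠ 1 →
      ∀ x y : fixedField (Subgroup.zpowers σ),
      (curve480a1.baseChange (fixedField (Subgroup.zpowers σ))).toAffine.Nonsingular x y →
      x ≠ 0 → x ≠ -2 → x ≠ 3 → IsSquare (Algebra.norm ℚ x) → IsSquare (Algebra.norm ℚ (x + 2)) →
      IsSquare x ∧ IsSquare (x + 2)) :
    DokchitserDokchitser2011_mordellWeilRank_480a1_F5 :=
  F5.mordellWeilRank_curve480a1_eq_one_of_quintic_normDescent (CyclotomicField 2651 ℚ) h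

set_option backward.isDefEq.respectTransparency false in
/-- **The `n = 5` witness of Theorem 2 from the norm-`1` parts of the six quintic `2`-descents**:
the tree's named fact `DokchitserDokchitser2011_rank_480a1_F5` (the field `F₅`, its splitting,
`rk E(F₅) = 1`) follows from the six norm-`1` descent statements (through
`DokchitserDokchitser2011_rank_480a1_F5_of_mordellWeilRank` of the F5 file).
[cite: DokchitserDokchitser2011RankModN, proof of Thm. 2] -/
theorem DokchitserDokchitser2011_rank_480a1_F5_of_quintic_normDescent
    (h : ∀ σ : Gal((F5 (CyclotomicField 2651 ℚ))/ℚ), σ ≠ 1 →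
      ∀ x y : fixedField (Subgroup.zpowers σ),
      (curve480a1.baseChange (fixedField (Subgroup.zpowers σ))).toAffine.Nonsingular x y →
      x ≠ 0 → x ≠ -2 → x ≠ 3 → IsSquare (Algebra.norm ℚ x) → IsSquare (Algebra.norm ℚ (x + 2)) →
      IsSquare x ∧ IsSquare (x + 2)) :
    DokchitserDokchitser2011_rank_480a1_F5 :=
  DokchitserDokchitser2011_rank_480a1_F5_of_mordellWeilRank
    (DokchitserDokchitser2011_mordellWeilRank_480a1_F5_of_quintic_normDescent h)

end Literature.Barriers.BirchSwinnertonDyer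

end
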